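/-
Copyright (c) 2026 the pub-hodgecm-mathlib formalisation cell (harness21).  Prover seats hodgecm-mathlib-LH5-p02 (g3: §1–§3; g4: §4): line LH3 (closer stub `stub_N9`), LETTER L1 clause (I₂),
RULING #13 brick (A4) THE SMOOTH MODEL (LH3-plan (g3) 2026-09-02T09:57:12Z; spec F0P3b-p01 (g16) `SPEC-E3-assembly.v1.md` §1 (A4)).
-/
import Literature.NumberTheory.Automorphic.ArchInnerFormChartOrbitalSmoothWalls   -- ★ p850547 (F0P3a-p07): `uniformlyProper_gprimeBlock_of_inRegG_place`; brings ★ `contDiff_coe_gprimeBlock_apply`, `ArchSmooth.exists_contDiff`, `chartTorusG_eq_centralizer`, `symm_archPiEquivCM_mem_centralizer_gprimeTorus_iff`, `uniformlyProper_of_le_of_compactSpace_quotient`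
import Literature.NumberTheory.Automorphic.ArchInnerFormChartLocal                -- ★ `chartTorusGLoc`, `forall_mem_chartTorusGLoc_comm`, `chartTorusGLoc_le_centralizer`, `mem_chartTorusG_iff_forall_mem_chartTorusGLoc`, `isClosed_chartTorusGLoc`
import Literature.NumberTheory.Automorphic.ArchU21SplitOrbitSmoothParam            -- ★ (e3-4b) p850891 (this seat): `contDiff_diagonal_boostEig`; brings ★ `boostEig`, `continuous_of_coe`, `StdForm.over_mul_over`
import Literature.MeasureTheory.Group.QuotientOrbitalIntegralFibreSmoothParam      -- ★ (A4-gen) p850913 (this seat): `contDiffOn_integral_prod_descConj_fibre_of_uniformlyProper_of_param`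
import Literature.MeasureTheory.Group.QuotientOrbitalIntegralProperContinuity      -- ★ `uniformlyProper_pi`, `uniformlyProper_mono`
import Literature.MeasureTheory.Group.UniformlyProperTransfer                      -- ★ `uniformlyProper_of_le_of_compactSpace_quotient`
import Literature.NumberTheory.Rogawski1990.ArchTransfFamilySymmetries             -- ★ `dense_regG`
import HarnessLib

/-!
# (A4) THE SMOOTH MODEL: the unfolded-at-the-split-places orbital integral `H S′ c` is `C^∞` on the whole in-regular set `InRegG s S′`
# (letter L1 clause (I₂) by «global parabolic descent at the split places», spec F0P3b-p01 (g16) §1 (A4))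

Topic `NumberTheory/Rogawski1990`; namespace `Literature.NumberTheory.Rogawski1990` (§1–§3 in `…Automorphic.UnitaryGroup`).  THEOREMS ONLY (no `def`, no instance, no notation, no
axiom, no named fact, no `sorry`); kernel lane `--kind proof --supports stmt-HodgeConjecture-24833`.  Cell `pub/hodgecm-mathlib`, crux H413 (`stmt-HodgeConjecture-24833`), F0∕P3c line LH3
(closer stub `stub_N9`, N9″ DIRECT ROAD), LETTER L1 `HcOrbitalFamiliesStatement`, clause (I₂) «`orbFamGExt ν′ a′ S′` is `C^∞` on `InRegG s S′`», RULING #13 (LH3-plan (g3)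
2026-09-02T09:57:12Z) brick **(A4) THE SMOOTH MODEL**, seat LH5-p02 (g3), IN BINDER FORM against the (A1)∕(A2)∕(A3)∕(A5) currency of `SPEC-E3-assembly.v1.md` §2.

THE MATHEMATICS (spec §0–§1).  On `RegG S′`, `orbFamG = archRG · chartOrbG`; writing `G′_∞ ⧸ T_{S′} ≅ Π_w U(α)_w ⧸ T′_{S′,w}` and replacing, at every SPLIT place `w ∈ S′`, the normalised
local orbital integral `Δ_w • ∫_{U_w ⧸ T′_w}` by the UNFOLDED `C_w • ∫_{K_w × N_w}` (★ (e3-4a) through ★ (e3-5)), one obtains the MODEL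
  `H S′ c = pref(c) · ∫_{(G_c ⧸ M_c) × Y} a′(ρ(y · γ_c(c) · y⁻¹, (k_j (m_j(c) s_j(c) n_j s_j(c)) k_j⁻¹)_{j ∈ S′})) d(μ ⊗ ν)`,
`G_c = Π_{i ∉ S′} U(α)_i` (compact-chart places), `M_c = Π_{i ∉ S′} T′_{S′,i}` (★ `chartTorusGLoc`), `γ_c(c) = (gprimeBlock α i S′ c)_{i ∉ S′}`, `Y = Π_{j ∈ S′} (K_j × N_j)` (compact `K_j`,
Heisenberg `N_j` of `U(J₃)(ℂ)`), movers `m_j(c) s_j(c) = τ(0, φ_j, θ_j) τ(x_j∕2, 0, 0)`, `s_j(c) = τ(x_j∕2, 0, 0)` of the torus family `τ c = diag(boostEig c)` (★ `exists_torusU_boostEig_family`),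
`ρ` the recombination `G_c × Π_{j∈S′} U(J₃)(ℂ) → G′_∞` (= `archPiEquivCM⁻¹ ∘ (id × Π_j φ_j⁻¹)`, ★ (e3-5); a binder here: continuous, PROPER, with a smooth ambient reading `Λ`), `pref`
the product of the compact-place normalising factors and the constants `C_j` (a binder, smooth on `InRegG`).  THIS FILE: **`H S′` is `ContDiffOn ℝ ∞` on ALL of `InRegG (slotSign α) S′`**
— no real wall, no scalar point, no corner excluded — by ONE call of ★ (A4-gen) `contDiffOn_integral_prod_descConj_fibre_of_uniformlyProper_of_param` on `(G_c ⧸ M_c) × Y`: (HYP) for the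
compact-place product = ★ `uniformlyProper_gprimeBlock_of_inRegG_place` per `i ∉ S′` (compact-wall points INCLUDED) ∘ ★ `uniformlyProper_pi` (§2; the local torus IS the centraliser at a
regular reference, §1); the `M_c`-invariant datum `p(y) = (Ad(y_i) b^{(i)}_k)_{i,k}` over bases of the commutants of the `T′_{S′,i}` and the factorisation `Ψ = Θ ∘ Λ` through the ambient
smooth lift `Θ` of `a′` (★ `ArchSmooth.exists_contDiff`) exactly as ★ `contDiffOn_chartOrbG_of_uniformlyProper`; the fibre support from `HasCompactSupport a′` + properness of `ρ` +
compact `K_j` + closed `N_j` (★ (e3-4b) §1); the movers smooth by ★ `contDiff_diagonal_boostEig`.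
* §1 `chartTorusGLoc_eq_centralizer_gprimeBlock` — `T′_{S′,w} = Z(gprimeBlock α w S′ c₁)` for `c₁ ∈ RegG S′` (★ global `chartTorusG_eq_centralizer` ∘ ★ placewise criteria).
* §2 `uniformlyProper_gprimeBlock_pi_inRegG` — (HYP) for `(G_c, M_c, γ_c)` on `InRegG (slotSign α) S′`.
* §3 `forall_mem_pi_chartTorusGLoc_comm` — `M_c` centralises `γ_c(c)` (the `descConj` binder).
* §4 (ED. 2) HEAD **`contDiffOn_smoothModel_inRegG`** — `hH : ContDiffOn ℝ ∞ (H S′) (InRegG (slotSign L α) S′)` in the binder form above (output consumed by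
  (A5) ★-glue `contDiffOn_orbFamGExt_inRegG_of_model`; with `contDiff_coe_gprimeBlock`, `contDiff_coe_torusFamily_comp`): ★ (A4-gen) `contDiffOn_integral_prod_descConj_fibre_of_uniformlyProper_of_param` fed with §2 ((HYP)), §3 (`hcomm`), the
  commutant-projection datum of ★ `contDiffOn_chartOrbG_of_uniformlyProper` per compact place, `Ψ = Θ ∘ Λ` (★ `ArchSmooth.exists_contDiff`), fibre support from `HasCompactSupport a′`
  + properness of `ρ` + compact `K_j` + closed `N_j`, movers ★ `contDiff_diagonal_boostEig`.  INDEXING: the compact-chart places are carried by an arbitrary family `e : ι → W` with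
  `e i ∉ S′` (a nested subtype index `{w // w ∉ S′}` makes the `Π`-group product time out at `isDefEq`; (A1) instantiates `ι`, `e`).
HONEST LABEL: HC_CM is proved only modulo the 7 printed citations (2 remaining named inputs: hLiu418 = `stmt-HodgeConjecture-24832`, h413 = `stmt-HodgeConjecture-24833`) until
rung 0 closes; count-neutral letter-L1 (I₂) pay-down (pays nothing by itself; (A5) assembles).

## References
* [Varadarajan1977] V. S. Varadarajan, *Harmonic Analysis on Real Reductive Groups*, LNM 576 (1977), Part I §1.12 (parabolic descent of `'F_f` at a Cartan without imaginary roots).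
* [Rogawski1990] J. D. Rogawski, *Automorphic Representations of Unitary Groups in Three Variables*, Ann. of Math. Stud. 123 (1990), §4.3 p. 43, §4.12 Lemma 4.12.1 p. 66, §8.2–§8.3 pp. 118–124.
* [Shelstad1979] D. Shelstad, *Characters and inner forms of a quasi-split group over ℝ*, Compositio Math. 39 (1979), §4 pp. 22–23.
* [Bouaziz1994IntegralesOrbitales] A. Bouaziz, *Intégrales orbitales sur les groupes de Lie réductifs*, Ann. Sci. ÉNS 27 (1994), §6.2 p. 591 (`T_{in-reg}`).
* [HormanderALPDO1] L. Hörmander, *The Analysis of Linear Partial Differential Operators I*, 2nd ed. (1990), §1.1 Thm. 1.1.9.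
* [HarishChandra1970] Harish-Chandra (notes by G. van Dijk), *Harmonic Analysis on Reductive p-adic Groups*, LNM 162 (1970), Part I §3 Lemma 22 (compactness lemma).
* [Knapp1986] A. W. Knapp, *Representation Theory of Semisimple Groups* (1986), Ch. V §3 (the noncompact Cartan of `SU(2,1)`, the boost `diag(e^{x+iθ}, e^{iφ}, e^{−x+iθ})`).
-/

set_option autoImplicit false

noncomputable section

open MeasureTheory MeasureTheory.Measure Matrix NumberField NumberField.InfinitePlace NumberField.mixedEmbedding Set Function Topology Complex
open Literature.MeasureTheory.Group Literature.NumberTheory.Rogawski1990 Literature.NumberTheory.Automorphic.ArchCartan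
open Literature.NumberTheory.Automorphic.UnitaryGroup
open scoped MatrixGroups ContDiff Classical
open scoped Matrix.Norms.Operator

/-! ## §1 The local chart torus is the centraliser at a regular reference; §2 (HYP) for the compact-place product; §3 the `descConj` binder -/

namespace Literature.NumberTheory.Automorphic.UnitaryGroup

section Local

variable (L : Type) [Field L] [NumberField L] [IsCMField L] (α : Fin 3 → L) (S' : Finset {w : InfinitePlace L // IsComplex w})

/-- **`T′_{S′,w} = Z(gprimeBlock α w S′ c₁)` at a regular reference `c₁ ∈ RegG S′`** (frame hypotheses): `≤` is ★ `chartTorusGLoc_le_centralizer`; `≥`: a local element centralising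
`gprimeBlock α w S′ c₁`, padded with the chart point at the other places, centralises `gprimeTorus α S′ c₁` (★ `symm_archPiEquivCM_mem_centralizer_gprimeTorus_iff`), hence lies in
`T_{S′} = Z(gprimeTorus α S′ c₁)` (★ `chartTorusG_eq_centralizer`), whose `w`-component lies in `T′_{S′,w}` (★ `mem_chartTorusG_iff_forall_mem_chartTorusGLoc`).
[cite: Rogawski1990, §3.6 p. 31] [cite: Shelstad1979, §4 p. 22] -/
theorem chartTorusGLoc_eq_centralizer_gprimeBlock (hα : ∀ i, α i ≠ 0) (hS' : ∀ w, w ∈ S' → w ∈ splitChartPlaces L α)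
    {c₁ : {w : InfinitePlace L // IsComplex w} → Fin 3 → ℝ} (hc₁ : c₁ ∈ RegG S') (w : {w : InfinitePlace L // IsComplex w}) :
    chartTorusGLoc L α w S' = Subgroup.centralizer ({gprimeBlock L α w S' c₁} : Set ↥(archLocal L 3 (Matrix.diagonal α) w)) := by
  refine le_antisymm (chartTorusGLoc_le_centralizer L α w S' (c₁ w)) fun g hg => ?_
  set G : ∀ v : {w : InfinitePlace L // IsComplex w}, ↥(archLocal L 3 (Matrix.diagonal α) v) :=
    Function.update (fun v => gprimeBlock L α v S' c₁) w g with hG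
  have hGmem : G ∈ Subgroup.pi Set.univ fun v => Subgroup.centralizer ({gprimeBlock L α v S' c₁} : Set ↥(archLocal L 3 (Matrix.diagonal α) v)) := by
    refine (Subgroup.mem_pi _).2 fun v _ => ?_
    by_cases hv : v = w
    · subst hv
      rw [hG, Function.update_self]
      exact hg
    · rw [hG, Function.update_of_ne hv]
      exact Subgroup.mem_centralizer_singleton_iff.2 rfl
  have hZ := (symm_archPiEquivCM_mem_centralizer_gprimeTorus_iff L α S' c₁ G).2 hGmem
  rw [← chartTorusG_eq_centralizer L α S' hα hS' hc₁, mem_chartTorusG_iff_forall_mem_chartTorusGLoc L α S' hα hS'] at hZ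
  have hw := hZ w
  rw [ContinuousMulEquiv.apply_symm_apply, hG, Function.update_self] at hw
  exact hw

/-- **(HYP) FOR THE COMPACT-PLACE PRODUCT `(Π_i U(α)_{e i}, Π_i T′_{S′,e i}, c ↦ (gprimeBlock α (e i) S′ c)_i)` ON `InRegG (slotSign α) S′`**, for ANY family `e : ι → W` of
compact-chart places (`e i ∉ S′`; (A1) takes `ι = {w // w ∉ S′}`, `e = Subtype.val`) — compact-wall points, corners of any depth and all split coordinates INCLUDED (the chart ignores the split
places): ★ `uniformlyProper_gprimeBlock_of_inRegG_place` per compact-chart place (modulo the centraliser at a regular reference, = `T′_{S′,e i}` by §1, transferred by ★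
`uniformlyProper_of_le_of_compactSpace_quotient`) ∘ ★ `uniformlyProper_pi`. [cite: Rogawski1990, §4.12 Lemma 4.12.1 p. 66; §4.3 p. 43] [cite: HarishChandra1970, Part I §3 Lemma 22]
[cite: Bouaziz1994IntegralesOrbitales, §6.2 p. 591] -/
theorem uniformlyProper_gprimeBlock_pi_inRegG (hα : ∀ i, α i ≠ 0) (hreal : ∀ (w : {w : InfinitePlace L // IsComplex w}) (i : Fin 3), (w.1.embedding (α i)).im = 0)
    (hS' : ∀ w, w ∈ S' → w ∈ splitChartPlaces L α) {ι : Type} [Fintype ι] (e : ι → {w : InfinitePlace L // IsComplex w}) (he : ∀ i, e i ∉ S') :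
    ∀ K ⊆ InRegG (slotSign L α) S', IsCompact K →
      ∀ C : Set (∀ i : ι, ↥(archLocal L 3 (Matrix.diagonal α) (e i))), IsCompact C →
        ∃ 𝒦 : Set ((∀ i : ι, ↥(archLocal L 3 (Matrix.diagonal α) (e i))) ⧸ Subgroup.pi Set.univ (fun i : ι => chartTorusGLoc L α (e i) S')),
          IsCompact 𝒦 ∧ ∀ c ∈ K, ∀ y : (∀ i : ι, ↥(archLocal L 3 (Matrix.diagonal α) (e i))),
            y * (fun i => gprimeBlock L α (e i) S' c) * y⁻¹ ∈ C →
              (QuotientGroup.mk y : (∀ i : ι, ↥(archLocal L 3 (Matrix.diagonal α) (e i))) ⧸ Subgroup.pi Set.univ (fun i : ι => chartTorusGLoc L α (e i) S')) ∈ 𝒦 := by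
  obtain ⟨c₁, hc₁⟩ := (dense_regG S').nonempty
  haveI : ∀ i : ι, LocallyCompactSpace ↥(archLocal L 3 (Matrix.diagonal α) (e i)) := fun i => locallyCompactSpace_archLocal L 3 (Matrix.diagonal α) (e i)
  -- per compact-chart place: (HYP) modulo `T′_{S′,e i}` on the `InRegG`-slice
  have hplace : ∀ i : ι,
      ∀ K₁ ⊆ {cw : Fin 3 → ℝ | (e i ∈ S' → cw 0 ≠ 0) ∧ (e i ∉ S' → ∀ a b : Fin 3, a ≠ b → slotSign L α (e i) a ≠ slotSign L α (e i) b → Circle.exp (cw a) ≠ Circle.exp (cw b))},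
        IsCompact K₁ → ∀ C₁ : Set ↥(archLocal L 3 (Matrix.diagonal α) (e i)), IsCompact C₁ →
          ∃ 𝒦₁ : Set (↥(archLocal L 3 (Matrix.diagonal α) (e i)) ⧸ chartTorusGLoc L α (e i) S'), IsCompact 𝒦₁ ∧
            ∀ cw ∈ K₁, ∀ y : ↥(archLocal L 3 (Matrix.diagonal α) (e i)), y * gprimeBlockAt L α (e i) S' cw * y⁻¹ ∈ C₁ →
              (QuotientGroup.mk y : ↥(archLocal L 3 (Matrix.diagonal α) (e i)) ⧸ chartTorusGLoc L α (e i) S') ∈ 𝒦₁ := by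
    intro i
    have hle : chartTorusGLoc L α (e i) S' ≤ Subgroup.centralizer ({gprimeBlock L α (e i) S' c₁} : Set ↥(archLocal L 3 (Matrix.diagonal α) (e i))) :=
      chartTorusGLoc_le_centralizer L α (e i) S' (c₁ (e i))
    have heq := chartTorusGLoc_eq_centralizer_gprimeBlock L α S' hα hS' hc₁ (e i)
    haveI : CompactSpace (↥(Subgroup.centralizer ({gprimeBlock L α (e i) S' c₁} : Set ↥(archLocal L 3 (Matrix.diagonal α) (e i)))) ⧸
        (chartTorusGLoc L α (e i) S').subgroupOf (Subgroup.centralizer ({gprimeBlock L α (e i) S' c₁} : Set ↥(archLocal L 3 (Matrix.diagonal α) (e i))))) := by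
      have htop : (chartTorusGLoc L α (e i) S').subgroupOf (Subgroup.centralizer ({gprimeBlock L α (e i) S' c₁} : Set ↥(archLocal L 3 (Matrix.diagonal α) (e i)))) = ⊤ := by
        rw [heq, Subgroup.subgroupOf_self]
      rw [htop]
      infer_instance
    exact uniformlyProper_of_le_of_compactSpace_quotient _ _ hle _ _ (uniformlyProper_gprimeBlock_of_inRegG_place L α S' hα hreal hS' hc₁ (e i))
  -- places multiply
  have hpi := uniformlyProper_pi (fun i : ι => chartTorusGLoc L α (e i) S') (fun i cw => gprimeBlockAt L α (e i) S' cw) _ hplace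
  intro K hK hKc C hC
  have hK' : (fun c : {w : InfinitePlace L // IsComplex w} → Fin 3 → ℝ => fun i : ι => c (e i)) '' K ⊆
      Set.pi Set.univ fun i : ι =>
        {cw : Fin 3 → ℝ | (e i ∈ S' → cw 0 ≠ 0) ∧ (e i ∉ S' → ∀ a b : Fin 3, a ≠ b → slotSign L α (e i) a ≠ slotSign L α (e i) b → Circle.exp (cw a) ≠ Circle.exp (cw b))} := by
    rintro _ ⟨c, hc, rfl⟩ i -
    exact ⟨fun h => absurd h (he i), fun _ a b hab hs => hK hc (e i) (he i) a b hab hs⟩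
  obtain ⟨𝒦, h𝒦, hmem⟩ := hpi _ hK' (hKc.image (continuous_pi fun i => continuous_apply (e i))) C hC
  exact ⟨𝒦, h𝒦, fun c hc y hy => hmem _ ⟨c, hc, rfl⟩ y hy⟩

/-- **`M_c = Π_i T′_{S′,e i}` centralises the compact-place chart point `γ_c(c) = (gprimeBlock α (e i) S′ c)_i`** — the `descConj` binder of the model (★ `forall_mem_chartTorusGLoc_comm`
placewise). [cite: Rogawski1990, §8.2 p. 122] -/
theorem forall_mem_pi_chartTorusGLoc_comm {ι : Type} (e : ι → {w : InfinitePlace L // IsComplex w}) (c : {w : InfinitePlace L // IsComplex w} → Fin 3 → ℝ) :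
    ∀ m ∈ Subgroup.pi Set.univ (fun i : ι => chartTorusGLoc L α (e i) S'),
      m * (fun i : ι => gprimeBlock L α (e i) S' c) = (fun i : ι => gprimeBlock L α (e i) S' c) * m := by
  intro m hm
  funext i
  exact forall_mem_chartTorusGLoc_comm L α (e i) S' (c (e i)) (m i) ((Subgroup.mem_pi _).1 hm i (Set.mem_univ _))

end Local

end Literature.NumberTheory.Automorphic.UnitaryGroup


/-! ## §4 (ED. 2) HEAD: the smooth MODEL `H S′` of the raw orbital family is `C^∞` on ALL of `InRegG (slotSign α) S′` -/

namespace Literature.NumberTheory.Automorphic.UnitaryGroup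

section Model

variable (L : Type) [Field L] [NumberField L] [IsCMField L] (α : Fin 3 → L) (S' : Finset {w : InfinitePlace L // IsComplex w})

omit [IsCMField L] in
/-- **The chart block `c ↦ ↑↑(gprimeBlock α w S′ c) ∈ M₃(ℂ)` is `C^∞` in MATRIX currency** (entrywise ★ `contDiff_coe_gprimeBlock_apply`, assembled through the linear `Matrix.of`).
[cite: Rogawski1990, §3.6 p. 31; §8.2 p. 122] -/
theorem contDiff_coe_gprimeBlock (w : {w : InfinitePlace L // IsComplex w}) :
    ContDiff ℝ ∞ fun c : {w : InfinitePlace L // IsComplex w} → Fin 3 → ℝ =>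
      (((gprimeBlock L α w S' c : ↥(archLocal L 3 (Matrix.diagonal α) w)) : GL (Fin 3) ℂ) : Matrix (Fin 3) (Fin 3) ℂ) := by
  let Λ : (Fin 3 → Fin 3 → ℂ) →L[ℝ] Matrix (Fin 3) (Fin 3) ℂ :=
    LinearMap.toContinuousLinearMap (Matrix.ofLinearEquiv ℝ : (Fin 3 → Fin 3 → ℂ) ≃ₗ[ℝ] Matrix (Fin 3) (Fin 3) ℂ).toLinearMap
  have hΛ : ∀ g : Fin 3 → Fin 3 → ℂ, Λ g = Matrix.of g := fun _ => rfl
  have hfun : (fun c : {w : InfinitePlace L // IsComplex w} → Fin 3 → ℝ =>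
        (((gprimeBlock L α w S' c : ↥(archLocal L 3 (Matrix.diagonal α) w)) : GL (Fin 3) ℂ) : Matrix (Fin 3) (Fin 3) ℂ)) =
      fun c => Λ fun i j => (((gprimeBlock L α w S' c : ↥(archLocal L 3 (Matrix.diagonal α) w)) : GL (Fin 3) ℂ) : Matrix (Fin 3) (Fin 3) ℂ) i j := by
    funext c; rw [hΛ]; rfl
  rw [hfun]
  exact Λ.contDiff.comp (contDiff_pi.2 fun i => contDiff_pi.2 fun j => contDiff_coe_gprimeBlock_apply L α S' w i j)

/-- **The torus family read along a smooth coordinate map is `C^∞` in matrix currency**: `x ↦ ↑↑(τ (g x)) = diag(boostEig (g x))` for `C^∞` `g` (clause 2 of ★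
`exists_torusU_boostEig_family` — the binder `hτcoe` — composed with ★ `contDiff_diagonal_boostEig`). [cite: Rogawski1990, §1.10 p. 9] [cite: Knapp1986, Ch. V §3] -/
theorem contDiff_coe_torusFamily_comp {X : Type*} [NormedAddCommGroup X] [NormedSpace ℝ X] {J : Matrix (Fin 3) (Fin 3) ℂ}
    (τ : (Fin 3 → ℝ) → ↥(unitaryGroupOfForm (starRingEnd ℂ) J))
    (hτcoe : ∀ c, (((τ c : ↥(unitaryGroupOfForm (starRingEnd ℂ) J)) : GL (Fin 3) ℂ) : Matrix (Fin 3) (Fin 3) ℂ) = Matrix.diagonal (boostEig c))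
    {g : X → Fin 3 → ℝ} (hg : ContDiff ℝ ∞ g) :
    ContDiff ℝ ∞ fun x => (((τ (g x) : ↥(unitaryGroupOfForm (starRingEnd ℂ) J)) : GL (Fin 3) ℂ) : Matrix (Fin 3) (Fin 3) ℂ) := by
  have e : (fun x => (((τ (g x) : ↥(unitaryGroupOfForm (starRingEnd ℂ) J)) : GL (Fin 3) ℂ) : Matrix (Fin 3) (Fin 3) ℂ)) =
      fun x => Matrix.diagonal (boostEig (g x)) := funext fun x => hτcoe (g x)
  rw [e]
  exact contDiff_diagonal_boostEig.comp hg

/-- **(A4) HEAD — THE SMOOTH MODEL `H S′` IS `C^∞` ON ALL OF `InRegG (slotSign α) S′`** (binder form; no real wall, no scalar split point, no compact wall, no corner excluded).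
Data: the frame hypotheses `hα hreal hS′`; the compact-chart places as a family `e : ι → W` with `e i ∉ S′` ((A1)∕(A5): `ι = {w ∕∕ w ∉ S′}`, `e = Subtype.val`), the split places
of `S′` as a family `es : κι → W` ((A5): `κι = ↥S′`) entering only through the coordinates `c (es j)`; a measure `μ` finite on compacta on the compact-place quotient
`(Π_i U(α)_{e i}) ⧸ (Π_i T′_{S′,e i})` ((A1): the Weil quotient of `⊗_i ν′_i` by `⊗_i t_i`); the standard group `U(J₃)(ℂ)` (`hJ`), compact subgroups `K_j` and an s-finite
measure `ν` finite on compacta on the fibre `Y = Π_j (K_j × N)` ((A3): `⊗_j (κ_j ⊗ μ_{N,j})`); the torus family `τ` through its matrix `diag(boostEig c)` (`hτcoe`, clause 2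
of ★ `exists_torusU_boostEig_family`); the recombination `ρ : G_c × U(J₃)(ℂ)^{κι} → G′_∞` through TWO properties only — PROPERNESS `hρK` (the preimage of a compact set sits
in a product of compacts; (A5): ★ `exists_isCompact_prod_superset_preimage` for the homeomorphism `archPiEquivCM⁻¹ ∘ (id × Π_j φ_j⁻¹)`) and a SMOOTH AMBIENT READING
`hρΛ : ↑↑(ρ (g, u)) = Λ ((↑↑g_i)_i, (↑↑u_j)_j)` (`Λ` of class `C^∞` into `M₃(L ⊗ ℝ)`; it is linear); a test function `a′ ∈ C_c^∞(G′_∞)` (★ `ArchSmooth`); a prefactor `pref`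
smooth on `InRegG` (the compact-place normalising factors and the constants `C_j`).  Conclusion:
**`c ↦ pref c · ∫_{(G_c ⧸ M_c) × Y} a′(ρ(y · γ_c(c) · y⁻¹, (k_j · (τ(0, φ_j, θ_j) τ(x_j∕2, 0, 0) · n_j · τ(x_j∕2, 0, 0)) · k_j⁻¹)_j)) d(μ ⊗ ν)` is `ContDiffOn ℝ ∞` on
`InRegG (slotSign L α) S′`**, `γ_c(c) = (gprimeBlock α (e i) S′ c)_i`, `(x_j, φ_j, θ_j) = c (es j)` — ONE call of ★ (A4-gen)
`contDiffOn_integral_prod_descConj_fibre_of_uniformlyProper_of_param` on `(G_c ⧸ M_c) × Y`: (HYP) = §2; `hcomm` = §3; the `M_c`-invariant datum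
`p(y) = (Ad(↑↑y) b_k)_k` over a basis `(b_k)` of the commutant of `↑↑M_c` in `Π_i M₃(ℂ)` and the smooth factorisation `Ψ = Θ ∘ Λ ∘ (Σ_k ℓ_k(↑↑γ_c(c)) • p_k(y), movers)`
(`Θ` the ambient lift of `a′`, ★ `ArchSmooth.exists_contDiff`; VERBATIM the commutant-projection trick of ★ `contDiffOn_chartOrbG_of_uniformlyProper`); the group support
`C = A` and the fibre support `Y₀(K) = Π_j (K_j × N⁰_j)` from `tsupport a′` compact ∘ `hρK` (`N⁰_j` = the `n ∈ N` with `(m_j s_j)⁻¹ k⁻¹ u_j k s_j⁻¹ = n` for `c ∈ K`, `k ∈ K_j`,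
`u ∈ B`: a continuous image of a compact set cut back to the closed `N`, VERBATIM the `S₁∕N₀` step of ★ (e3-4b) `contDiff_integral_prod_conj_movers_param`); the movers
continuous in `U(J₃)(ℂ)` by ★ `continuous_of_coe` (`J₃² = 1`) and smooth in matrix currency by `contDiff_coe_torusFamily_comp`.  Output `hH` of the (A5) glue
★-ready `contDiffOn_orbFamGExt_inRegG_of_model` (F0P3b-p01 (g16)), which with (A1)∕(A2)∕(A3)'s identity `orbFamG = H S′` on `RegG S′` gives clause (I₂) of letter L1 on the chart.
[cite: Varadarajan1977, I §1.12] [cite: Rogawski1990, §8.2–§8.3 pp. 118–124; §4.12 Lemma 4.12.1 p. 66] [cite: Shelstad1979, §4 pp. 22–23]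
[cite: Bouaziz1994IntegralesOrbitales, §6.2 p. 591] [cite: HormanderALPDO1, §1.1 Thm. 1.1.9] -/
theorem contDiffOn_smoothModel_inRegG (hα : ∀ i, α i ≠ 0) (hreal : ∀ (w : {w : InfinitePlace L // IsComplex w}) (i : Fin 3), (w.1.embedding (α i)).im = 0)
    (hS' : ∀ w, w ∈ S' → w ∈ splitChartPlaces L α)
    {ι : Type} [Fintype ι] (e : ι → {w : InfinitePlace L // IsComplex w}) (he : ∀ i, e i ∉ S')
    {κι : Type} [Fintype κι] (es : κι → {w : InfinitePlace L // IsComplex w})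
    [MeasurableSpace ((∀ i : ι, ↥(archLocal L 3 (Matrix.diagonal α) (e i))) ⧸ Subgroup.pi Set.univ (fun i : ι => chartTorusGLoc L α (e i) S'))]
    [BorelSpace ((∀ i : ι, ↥(archLocal L 3 (Matrix.diagonal α) (e i))) ⧸ Subgroup.pi Set.univ (fun i : ι => chartTorusGLoc L α (e i) S'))]
    (μ : Measure ((∀ i : ι, ↥(archLocal L 3 (Matrix.diagonal α) (e i))) ⧸ Subgroup.pi Set.univ (fun i : ι => chartTorusGLoc L α (e i) S')))
    [IsFiniteMeasureOnCompacts μ]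
    {J : Matrix (Fin 3) (Fin 3) ℂ} (hJ : J = (StdForm.antidiagonal 3).over ℂ)
    [MeasurableSpace ↥(unitaryGroupOfForm (starRingEnd ℂ) J)] [BorelSpace ↥(unitaryGroupOfForm (starRingEnd ℂ) J)]
    (K : κι → Subgroup ↥(unitaryGroupOfForm (starRingEnd ℂ) J)) (hK : ∀ j, IsCompact (K j : Set ↥(unitaryGroupOfForm (starRingEnd ℂ) J)))
    (ν : Measure (∀ j : κι, ↥(K j) × ↥(unipotentU (starRingEnd ℂ) J))) [IsFiniteMeasureOnCompacts ν] [SFinite ν]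
    (τ : (Fin 3 → ℝ) → ↥(unitaryGroupOfForm (starRingEnd ℂ) J))
    (hτcoe : ∀ c, (((τ c : ↥(unitaryGroupOfForm (starRingEnd ℂ) J)) : GL (Fin 3) ℂ) : Matrix (Fin 3) (Fin 3) ℂ) = Matrix.diagonal (boostEig c))
    (ρ : (∀ i : ι, ↥(archLocal L 3 (Matrix.diagonal α) (e i))) × (κι → ↥(unitaryGroupOfForm (starRingEnd ℂ) J)) →
      ↥(arch (↥(maximalRealSubfield L)) L (IsCMField.complexConj L) 3 (Matrix.diagonal α)))
    (hρK : ∀ S₀ : Set ↥(arch (↥(maximalRealSubfield L)) L (IsCMField.complexConj L) 3 (Matrix.diagonal α)), IsCompact S₀ →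
      ∃ A : Set (∀ i : ι, ↥(archLocal L 3 (Matrix.diagonal α) (e i))), ∃ B : Set (κι → ↥(unitaryGroupOfForm (starRingEnd ℂ) J)),
        IsCompact A ∧ IsCompact B ∧ ρ ⁻¹' S₀ ⊆ A ×ˢ B)
    (Λ : (ι → Matrix (Fin 3) (Fin 3) ℂ) × (κι → Matrix (Fin 3) (Fin 3) ℂ) → Matrix (Fin 3) (Fin 3) (mixedSpace L)) (hΛ : ContDiff ℝ ∞ Λ)
    (hρΛ : ∀ (g : ∀ i : ι, ↥(archLocal L 3 (Matrix.diagonal α) (e i))) (u : κι → ↥(unitaryGroupOfForm (starRingEnd ℂ) J)),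
      (((ρ (g, u) : ↥(arch (↥(maximalRealSubfield L)) L (IsCMField.complexConj L) 3 (Matrix.diagonal α))) : GL (Fin 3) (mixedSpace L)) :
          Matrix (Fin 3) (Fin 3) (mixedSpace L)) =
        Λ (fun i => (((g i : ↥(archLocal L 3 (Matrix.diagonal α) (e i))) : GL (Fin 3) ℂ) : Matrix (Fin 3) (Fin 3) ℂ),
          fun j => (((u j : ↥(unitaryGroupOfForm (starRingEnd ℂ) J)) : GL (Fin 3) ℂ) : Matrix (Fin 3) (Fin 3) ℂ)))
    {a' : ↥(arch (↥(maximalRealSubfield L)) L (IsCMField.complexConj L) 3 (Matrix.diagonal α)) → ℂ} (ha' : ArchSmooth L 3 (Matrix.diagonal α) a')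
    (pref : ({w : InfinitePlace L // IsComplex w} → Fin 3 → ℝ) → ℂ) (hpref : ContDiffOn ℝ ∞ pref (InRegG (slotSign L α) S')) :
    ContDiffOn ℝ ∞ (fun c : {w : InfinitePlace L // IsComplex w} → Fin 3 → ℝ => pref c *
        ∫ w : ((∀ i : ι, ↥(archLocal L 3 (Matrix.diagonal α) (e i))) ⧸ Subgroup.pi Set.univ (fun i : ι => chartTorusGLoc L α (e i) S')) ×
            (∀ j : κι, ↥(K j) × ↥(unipotentU (starRingEnd ℂ) J)),
          descConj (fun i : ι => gprimeBlock L α (e i) S' c) (Subgroup.pi Set.univ (fun i : ι => chartTorusGLoc L α (e i) S'))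
            (forall_mem_pi_chartTorusGLoc_comm L α S' e c)
            (fun g => a' (ρ (g, fun j => ((w.2 j).1 : ↥(unitaryGroupOfForm (starRingEnd ℂ) J)) *
              (τ ![0, c (es j) 1, c (es j) 2] * τ ![c (es j) 0 / 2, 0, 0] * ((w.2 j).2 : ↥(unitaryGroupOfForm (starRingEnd ℂ) J)) * τ ![c (es j) 0 / 2, 0, 0]) *
              ((w.2 j).1 : ↥(unitaryGroupOfForm (starRingEnd ℂ) J))⁻¹)))
            w.1 ∂(μ.prod ν))
      (InRegG (slotSign L α) S') := by
  -- frame facts and instances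
  have hN : IsClosed (unipotentU (starRingEnd ℂ) J : Set ↥(unitaryGroupOfForm (starRingEnd ℂ) J)) := LineRing.isClosed_unipotentU _ _
  have hJJ : J * J = 1 := by rw [hJ]; exact StdForm.over_mul_over _ _
  haveI : LocallyCompactSpace ↥(unitaryGroupOfForm (starRingEnd ℂ) J) := locallyCompactSpace_unitaryGroupOfForm_complex J
  haveI : SecondCountableTopology ↥(unitaryGroupOfForm (starRingEnd ℂ) J) := secondCountableTopology_unitaryGroupOfForm_complex J
  haveI : SecondCountableTopology ↥(unipotentU (starRingEnd ℂ) J) := TopologicalSpace.Subtype.secondCountableTopology _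
  haveI : ∀ j, SecondCountableTopology ↥(K j) := fun j => TopologicalSpace.Subtype.secondCountableTopology _
  haveI : BorelSpace ↥(unipotentU (starRingEnd ℂ) J) := Subtype.borelSpace _
  haveI : ∀ j, BorelSpace ↥(K j) := fun j => Subtype.borelSpace _
  haveI : ∀ j, BorelSpace (↥(K j) × ↥(unipotentU (starRingEnd ℂ) J)) := fun j => Prod.borelSpace
  haveI : ∀ j, CompactSpace ↥(K j) := fun j => isCompact_iff_compactSpace.1 (hK j)
  haveI : IsClosed ((Subgroup.pi Set.univ (fun i : ι => chartTorusGLoc L α (e i) S')) : Set (∀ i : ι, ↥(archLocal L 3 (Matrix.diagonal α) (e i)))) := by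
    rw [Subgroup.coe_pi]
    exact isClosed_set_pi fun i _ => isClosed_chartTorusGLoc L α (e i) S'
  obtain ⟨Θ, hΘ, -, -, hΘf⟩ := ha'.exists_contDiff
  -- the compact-place matrix reading `Ebar : G_c → Π_i M₃(ℂ)` (multiplicative, continuous; `c ↦ Ebar (γ_c c)` smooth)
  let Ebar : (∀ i : ι, ↥(archLocal L 3 (Matrix.diagonal α) (e i))) → (ι → Matrix (Fin 3) (Fin 3) ℂ) :=
    fun y i => (((y i : ↥(archLocal L 3 (Matrix.diagonal α) (e i))) : GL (Fin 3) ℂ) : Matrix (Fin 3) (Fin 3) ℂ)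
  have hEmul : ∀ x y, Ebar (x * y) = Ebar x * Ebar y := fun x y => by
    funext i
    simp only [Ebar, Pi.mul_apply, Subgroup.coe_mul, Units.val_mul]
  have hEone : Ebar 1 = 1 := by
    funext i
    simp only [Ebar, Pi.one_apply, OneMemClass.coe_one, Units.val_one]
  have hEinv : ∀ x, Ebar x * Ebar x⁻¹ = 1 := fun x => by rw [← hEmul, mul_inv_cancel, hEone]
  have hEcont : Continuous Ebar :=
    continuous_pi fun i => (Units.continuous_val.comp continuous_subtype_val).comp (continuous_apply i)
  have hEγ : ContDiff ℝ ∞ fun c : {w : InfinitePlace L // IsComplex w} → Fin 3 → ℝ => Ebar (fun i : ι => gprimeBlock L α (e i) S' c) :=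
    contDiff_pi.2 fun i => contDiff_coe_gprimeBlock L α S' (e i)
  -- the commutant of `Ebar '' M_c` in `Π_i M₃(ℂ)` and a linear projection onto it
  let A : Submodule ℝ (ι → Matrix (Fin 3) (Fin 3) ℂ) :=
    { carrier := {m | ∀ s ∈ Subgroup.pi Set.univ (fun i : ι => chartTorusGLoc L α (e i) S'), Ebar s * m = m * Ebar s}
      add_mem' := fun {a b} ha hb s hs => by rw [mul_add, add_mul, ha s hs, hb s hs]
      zero_mem' := fun s _ => by rw [mul_zero, zero_mul]
      smul_mem' := fun r m hm s hs => by
        show Ebar s * (r • m) = r • m * Ebar s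
        rw [mul_smul_comm, smul_mul_assoc, hm s hs] }
  have hAmem : ∀ m, m ∈ A ↔ ∀ s ∈ Subgroup.pi Set.univ (fun i : ι => chartTorusGLoc L α (e i) S'), Ebar s * m = m * Ebar s := fun _ => Iff.rfl
  obtain ⟨B, hAB⟩ := A.exists_isCompl
  let b := Module.finBasis ℝ A
  let ℓ : Fin (Module.finrank ℝ A) → (ι → Matrix (Fin 3) (Fin 3) ℂ) →ₗ[ℝ] ℝ := fun k => (b.coord k) ∘ₗ (A.projectionOnto B hAB)
  have hℓ : ∀ k, ContDiff ℝ ∞ fun m : ι → Matrix (Fin 3) (Fin 3) ℂ => ℓ k m := fun k =>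
    (LinearMap.toContinuousLinearMap (ℓ k)).contDiff
  have hrec : ∀ m ∈ A, ∑ k, ℓ k m • ((b k : A) : ι → Matrix (Fin 3) (Fin 3) ℂ) = m := by
    intro m hm
    have h1 : A.projectionOnto B hAB m = ⟨m, hm⟩ := Submodule.projectionOnto_apply_of_mem_left hAB hm
    have h2 := congrArg (fun x : A => (x : ι → Matrix (Fin 3) (Fin 3) ℂ)) (b.sum_repr (⟨m, hm⟩ : A))
    simp only [AddSubmonoidClass.coe_finsetSum, SetLike.val_smul] at h2
    have h3 : ∀ k, ℓ k m = b.repr (⟨m, hm⟩ : A) k := fun k => by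
      show b.coord k (A.projectionOnto B hAB m) = _
      rw [h1, Module.Basis.coord_apply]
    simp only [h3]
    exact h2
  have hmem : ∀ c : {w : InfinitePlace L // IsComplex w} → Fin 3 → ℝ, Ebar (fun i : ι => gprimeBlock L α (e i) S' c) ∈ A := fun c s hs => by
    rw [← hEmul, ← hEmul, forall_mem_pi_chartTorusGLoc_comm L α S' e c s hs]
  -- the `M_c`-invariant datum `p(y) = (Ad(↑↑y) b_k)_k`
  let p : (∀ i : ι, ↥(archLocal L 3 (Matrix.diagonal α) (e i))) → Fin (Module.finrank ℝ A) → (ι → Matrix (Fin 3) (Fin 3) ℂ) :=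
    fun h k => Ebar h * ((b k : A) : ι → Matrix (Fin 3) (Fin 3) ℂ) * Ebar h⁻¹
  have hp : Continuous p :=
    continuous_pi fun k => (hEcont.mul continuous_const).mul (hEcont.comp continuous_inv)
  have hpM : ∀ y, ∀ m ∈ Subgroup.pi Set.univ (fun i : ι => chartTorusGLoc L α (e i) S'), p (y * m) = p y := by
    intro y s hs
    funext k
    have hc : Ebar s * ((b k : A) : ι → Matrix (Fin 3) (Fin 3) ℂ) = ((b k : A) : ι → Matrix (Fin 3) (Fin 3) ℂ) * Ebar s :=
      (hAmem _).1 (b k).2 s hs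
    show Ebar (y * s) * ((b k : A) : ι → Matrix (Fin 3) (Fin 3) ℂ) * Ebar (y * s)⁻¹ =
      Ebar y * ((b k : A) : ι → Matrix (Fin 3) (Fin 3) ℂ) * Ebar y⁻¹
    rw [_root_.mul_inv_rev, hEmul, hEmul]
    calc Ebar y * Ebar s * ((b k : A) : ι → Matrix (Fin 3) (Fin 3) ℂ) * (Ebar s⁻¹ * Ebar y⁻¹)
        = Ebar y * (Ebar s * ((b k : A) : ι → Matrix (Fin 3) (Fin 3) ℂ) * Ebar s⁻¹) * Ebar y⁻¹ := by simp only [mul_assoc]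
      _ = Ebar y * ((b k : A) : ι → Matrix (Fin 3) (Fin 3) ℂ) * Ebar y⁻¹ := by
          rw [hc, mul_assoc (((b k : A) : ι → Matrix (Fin 3) (Fin 3) ℂ)), hEinv, mul_one]
  have hsum : ∀ (y : ∀ i : ι, ↥(archLocal L 3 (Matrix.diagonal α) (e i))) (m : ι → Matrix (Fin 3) (Fin 3) ℂ),
      ∑ k, ℓ k m • p y k = Ebar y * (∑ k, ℓ k m • ((b k : A) : ι → Matrix (Fin 3) (Fin 3) ℂ)) * Ebar y⁻¹ := by
    intro y m
    rw [Finset.mul_sum, Finset.sum_mul]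
    exact Finset.sum_congr rfl fun k _ => by rw [mul_smul_comm, smul_mul_assoc]
  -- the fibre datum `r(η) = (↑↑k_j, ↑↑n_j, ↑↑k_j⁻¹)_j`
  have hcoe : Continuous fun w : ↥(unitaryGroupOfForm (starRingEnd ℂ) J) => ((w : GL (Fin 3) ℂ) : Matrix (Fin 3) (Fin 3) ℂ) :=
    Units.continuous_val.comp continuous_subtype_val
  let r : (∀ j : κι, ↥(K j) × ↥(unipotentU (starRingEnd ℂ) J)) → (κι → Matrix (Fin 3) (Fin 3) ℂ × Matrix (Fin 3) (Fin 3) ℂ × Matrix (Fin 3) (Fin 3) ℂ) :=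
    fun η j => ((((((η j).1 : ↥(K j)) : ↥(unitaryGroupOfForm (starRingEnd ℂ) J)) : GL (Fin 3) ℂ) : Matrix (Fin 3) (Fin 3) ℂ),
      (((((η j).2 : ↥(unipotentU (starRingEnd ℂ) J)) : ↥(unitaryGroupOfForm (starRingEnd ℂ) J)) : GL (Fin 3) ℂ) : Matrix (Fin 3) (Fin 3) ℂ),
      ((((((η j).1 : ↥(K j)) : ↥(unitaryGroupOfForm (starRingEnd ℂ) J))⁻¹ : ↥(unitaryGroupOfForm (starRingEnd ℂ) J)) : GL (Fin 3) ℂ) :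
        Matrix (Fin 3) (Fin 3) ℂ))
  have hr : Continuous r := by
    refine continuous_pi fun j => ?_
    have hη : Continuous fun η : (∀ j : κι, ↥(K j) × ↥(unipotentU (starRingEnd ℂ) J)) => η j := continuous_apply j
    exact (hcoe.comp (continuous_subtype_val.comp (continuous_fst.comp hη))).prodMk
      ((hcoe.comp (continuous_subtype_val.comp (continuous_snd.comp hη))).prodMk
        (hcoe.comp ((continuous_subtype_val.comp (continuous_fst.comp hη)).inv)))
  -- movers: smooth coordinate vectors, continuity in `U(J₃)(ℂ)` (★ `continuous_of_coe`, `J₃² = 1`)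
  have hgm : ∀ j : κι, ContDiff ℝ ∞ fun c : {w : InfinitePlace L // IsComplex w} → Fin 3 → ℝ => (![0, c (es j) 1, c (es j) 2] : Fin 3 → ℝ) := fun j => by
    refine contDiff_pi.2 fun i => ?_
    fin_cases i
    · exact contDiff_const
    · exact contDiff_apply_apply ℝ ℝ (es j) 1
    · exact contDiff_apply_apply ℝ ℝ (es j) 2
  have hgs : ∀ j : κι, ContDiff ℝ ∞ fun c : {w : InfinitePlace L // IsComplex w} → Fin 3 → ℝ => (![c (es j) 0 / 2, 0, 0] : Fin 3 → ℝ) := fun j => by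
    refine contDiff_pi.2 fun i => ?_
    fin_cases i
    · exact (contDiff_apply_apply ℝ ℝ (es j) 0).div_const 2
    · exact contDiff_const
    · exact contDiff_const
  have hct : ∀ g : ({w : InfinitePlace L // IsComplex w} → Fin 3 → ℝ) → (Fin 3 → ℝ), ContDiff ℝ ∞ g →
      Continuous fun c => τ (g c) := fun g hg =>
    continuous_of_coe Complex.continuous_conj hJJ (contDiff_coe_torusFamily_comp τ hτcoe hg).continuous
  -- the integrand `Φ c g η = a′ (ρ (g, u(c, η)))` and the smooth factorisation `Ψ`
  obtain ⟨Φ, hΦ⟩ : ∃ Φ : ({w : InfinitePlace L // IsComplex w} → Fin 3 → ℝ) → (∀ i : ι, ↥(archLocal L 3 (Matrix.diagonal α) (e i))) →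
      (∀ j : κι, ↥(K j) × ↥(unipotentU (starRingEnd ℂ) J)) → ℂ,
      Φ = fun c g η => a' (ρ (g, fun j => ((η j).1 : ↥(unitaryGroupOfForm (starRingEnd ℂ) J)) *
        (τ ![0, c (es j) 1, c (es j) 2] * τ ![c (es j) 0 / 2, 0, 0] * ((η j).2 : ↥(unitaryGroupOfForm (starRingEnd ℂ) J)) * τ ![c (es j) 0 / 2, 0, 0]) *
        ((η j).1 : ↥(unitaryGroupOfForm (starRingEnd ℂ) J))⁻¹)) := ⟨_, rfl⟩
  obtain ⟨Ψ, hΨdef⟩ : ∃ Ψ : ((Fin (Module.finrank ℝ A) → (ι → Matrix (Fin 3) (Fin 3) ℂ)) ×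
        (κι → Matrix (Fin 3) (Fin 3) ℂ × Matrix (Fin 3) (Fin 3) ℂ × Matrix (Fin 3) (Fin 3) ℂ)) × ({w : InfinitePlace L // IsComplex w} → Fin 3 → ℝ) → ℂ,
      Ψ = fun q => Θ (Λ (∑ k, ℓ k (Ebar fun i : ι => gprimeBlock L α (e i) S' q.2) • q.1.1 k,
        fun j => (q.1.2 j).1 *
          ((((τ ![0, q.2 (es j) 1, q.2 (es j) 2] : ↥(unitaryGroupOfForm (starRingEnd ℂ) J)) : GL (Fin 3) ℂ) : Matrix (Fin 3) (Fin 3) ℂ) *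
            (((τ ![q.2 (es j) 0 / 2, 0, 0] : ↥(unitaryGroupOfForm (starRingEnd ℂ) J)) : GL (Fin 3) ℂ) : Matrix (Fin 3) (Fin 3) ℂ) * (q.1.2 j).2.1 *
            (((τ ![q.2 (es j) 0 / 2, 0, 0] : ↥(unitaryGroupOfForm (starRingEnd ℂ) J)) : GL (Fin 3) ℂ) : Matrix (Fin 3) (Fin 3) ℂ)) *
          (q.1.2 j).2.2)) := ⟨_, rfl⟩
  have hΨ : ContDiff ℝ ∞ Ψ := by
    rw [hΨdef]
    refine hΘ.comp (hΛ.comp (ContDiff.prodMk ?_ ?_))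
    · refine ContDiff.sum fun k _ => ?_
      exact ((hℓ k).comp (hEγ.comp contDiff_snd)).smul ((contDiff_apply ℝ (ι → Matrix (Fin 3) (Fin 3) ℂ) k).comp (contDiff_fst.comp contDiff_fst))
    · refine contDiff_pi.2 fun j => ?_
      have hD : ContDiff ℝ ∞ fun q : ((Fin (Module.finrank ℝ A) → (ι → Matrix (Fin 3) (Fin 3) ℂ)) ×
          (κι → Matrix (Fin 3) (Fin 3) ℂ × Matrix (Fin 3) (Fin 3) ℂ × Matrix (Fin 3) (Fin 3) ℂ)) × ({w : InfinitePlace L // IsComplex w} → Fin 3 → ℝ) => q.1.2 j :=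
        (contDiff_apply ℝ (Matrix (Fin 3) (Fin 3) ℂ × Matrix (Fin 3) (Fin 3) ℂ × Matrix (Fin 3) (Fin 3) ℂ) j).comp (contDiff_snd.comp contDiff_fst)
      have hm := contDiff_coe_torusFamily_comp τ hτcoe ((hgm j).comp (contDiff_snd (E := (Fin (Module.finrank ℝ A) → (ι → Matrix (Fin 3) (Fin 3) ℂ)) ×
          (κι → Matrix (Fin 3) (Fin 3) ℂ × Matrix (Fin 3) (Fin 3) ℂ × Matrix (Fin 3) (Fin 3) ℂ)) (F := {w : InfinitePlace L // IsComplex w} → Fin 3 → ℝ)))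
      have hs := contDiff_coe_torusFamily_comp τ hτcoe ((hgs j).comp (contDiff_snd (E := (Fin (Module.finrank ℝ A) → (ι → Matrix (Fin 3) (Fin 3) ℂ)) ×
          (κι → Matrix (Fin 3) (Fin 3) ℂ × Matrix (Fin 3) (Fin 3) ℂ × Matrix (Fin 3) (Fin 3) ℂ)) (F := {w : InfinitePlace L // IsComplex w} → Fin 3 → ℝ)))
      exact ((contDiff_fst.comp hD).mul (((hm.mul hs).mul (contDiff_fst.comp (contDiff_snd.comp hD))).mul hs)).mul
        (contDiff_snd.comp (contDiff_snd.comp hD))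
  have hfac : ∀ (c : {w : InfinitePlace L // IsComplex w} → Fin 3 → ℝ) (y : ∀ i : ι, ↥(archLocal L 3 (Matrix.diagonal α) (e i)))
      (η : ∀ j : κι, ↥(K j) × ↥(unipotentU (starRingEnd ℂ) J)),
      Φ c (y * (fun i : ι => gprimeBlock L α (e i) S' c) * y⁻¹) η = Ψ ((p y, r η), c) := by
    intro c y η
    have h1 : Ebar (y * (fun i : ι => gprimeBlock L α (e i) S' c) * y⁻¹) = ∑ k, ℓ k (Ebar fun i : ι => gprimeBlock L α (e i) S' c) • p y k := by
      rw [hsum, hrec _ (hmem c), ← hEmul, ← hEmul]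
    rw [hΦ, hΨdef]
    simp only
    rw [hΘf, hρΛ]
    congr 1
    congr 1
    refine Prod.ext h1 (funext fun j => ?_)
    simp only [r, Subgroup.coe_mul, Units.val_mul]
  -- supports: `tsupport a′` is compact and `ρ` is proper
  obtain ⟨A₀, B₀, hA₀, hB₀, hAB₀⟩ := hρK (tsupport a') ha'.hasCompactSupport.isCompact
  have hΦC : ∀ c ∈ InRegG (slotSign L α) S', ∀ g ∉ A₀, ∀ η, Φ c g η = 0 := by
    intro c _ g hg η
    rw [hΦ]
    exact image_eq_zero_of_notMem_tsupport fun h => hg (Set.mem_prod.1 (hAB₀ h)).1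
  have hfib : ∀ K₀ ⊆ InRegG (slotSign L α) S', IsCompact K₀ →
      ∃ Y₀ : Set (∀ j : κι, ↥(K j) × ↥(unipotentU (starRingEnd ℂ) J)), IsCompact Y₀ ∧ ∀ c ∈ K₀, ∀ g, ∀ η ∉ Y₀, Φ c g η = 0 := by
    intro K₀ _ hK₀
    -- per split place: the `n_j` that can contribute, for `c ∈ K₀`, lie in ONE compact subset of `N`
    have hΞ : ∀ j : κι, ∃ N₀ : Set ↥(unipotentU (starRingEnd ℂ) J), IsCompact N₀ ∧
        ∀ c ∈ K₀, ∀ (k : ↥(K j)) (n : ↥(unipotentU (starRingEnd ℂ) J)) (u : κι → ↥(unitaryGroupOfForm (starRingEnd ℂ) J)), u ∈ B₀ →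
          u j = (k : ↥(unitaryGroupOfForm (starRingEnd ℂ) J)) *
            (τ ![0, c (es j) 1, c (es j) 2] * τ ![c (es j) 0 / 2, 0, 0] * (n : ↥(unitaryGroupOfForm (starRingEnd ℂ) J)) * τ ![c (es j) 0 / 2, 0, 0]) *
            (k : ↥(unitaryGroupOfForm (starRingEnd ℂ) J))⁻¹ → n ∈ N₀ := by
      intro j
      obtain ⟨Ξ, hΞdef⟩ : ∃ Ξ : (({w : InfinitePlace L // IsComplex w} → Fin 3 → ℝ) × ↥(unitaryGroupOfForm (starRingEnd ℂ) J)) ×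
          ↥(unitaryGroupOfForm (starRingEnd ℂ) J) → ↥(unitaryGroupOfForm (starRingEnd ℂ) J),
          Ξ = fun q => (τ ![0, q.1.1 (es j) 1, q.1.1 (es j) 2] * τ ![q.1.1 (es j) 0 / 2, 0, 0])⁻¹ * ((q.1.2)⁻¹ * q.2 * q.1.2) *
            (τ ![q.1.1 (es j) 0 / 2, 0, 0])⁻¹ := ⟨_, rfl⟩
      have hΞc : Continuous Ξ := by
        rw [hΞdef]
        have h1 : Continuous fun q : (({w : InfinitePlace L // IsComplex w} → Fin 3 → ℝ) × ↥(unitaryGroupOfForm (starRingEnd ℂ) J)) ×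
            ↥(unitaryGroupOfForm (starRingEnd ℂ) J) => τ ![0, q.1.1 (es j) 1, q.1.1 (es j) 2] :=
          (hct _ (hgm j)).comp (continuous_fst.comp continuous_fst)
        have h2 : Continuous fun q : (({w : InfinitePlace L // IsComplex w} → Fin 3 → ℝ) × ↥(unitaryGroupOfForm (starRingEnd ℂ) J)) ×
            ↥(unitaryGroupOfForm (starRingEnd ℂ) J) => τ ![q.1.1 (es j) 0 / 2, 0, 0] :=
          (hct _ (hgs j)).comp (continuous_fst.comp continuous_fst)
        have hk : Continuous fun q : (({w : InfinitePlace L // IsComplex w} → Fin 3 → ℝ) × ↥(unitaryGroupOfForm (starRingEnd ℂ) J)) ×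
            ↥(unitaryGroupOfForm (starRingEnd ℂ) J) => q.1.2 := continuous_snd.comp continuous_fst
        exact ((h1.mul h2).inv.mul ((hk.inv.mul continuous_snd).mul hk)).mul h2.inv
      refine ⟨Subtype.val ⁻¹' (Ξ '' ((K₀ ×ˢ (K j : Set ↥(unitaryGroupOfForm (starRingEnd ℂ) J))) ×ˢ (Function.eval j '' B₀))),
        hN.isClosedEmbedding_subtypeVal.isCompact_preimage (((hK₀.prod (hK j)).prod (hB₀.image (continuous_apply j))).image hΞc), ?_⟩
      intro c hc k n u hu hj
      refine ⟨((c, (k : ↥(unitaryGroupOfForm (starRingEnd ℂ) J))), u j), Set.mk_mem_prod (Set.mk_mem_prod hc k.2) ⟨u, hu, rfl⟩, ?_⟩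
      rw [hΞdef, hj]
      simp only
      group
    choose N₀ hN₀c hN₀ using hΞ
    refine ⟨Set.pi Set.univ fun j => (Set.univ : Set ↥(K j)) ×ˢ N₀ j, isCompact_univ_pi fun j => isCompact_univ.prod (hN₀c j), ?_⟩
    intro c hc g η hη
    rw [hΦ]
    by_contra hne
    apply hη
    have huB := (Set.mem_prod.1 (hAB₀ (show ρ (g, fun j => ((η j).1 : ↥(unitaryGroupOfForm (starRingEnd ℂ) J)) *
        (τ ![0, c (es j) 1, c (es j) 2] * τ ![c (es j) 0 / 2, 0, 0] * ((η j).2 : ↥(unitaryGroupOfForm (starRingEnd ℂ) J)) * τ ![c (es j) 0 / 2, 0, 0]) *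
        ((η j).1 : ↥(unitaryGroupOfForm (starRingEnd ℂ) J))⁻¹) ∈ tsupport a' from by
      by_contra hout
      exact hne (image_eq_zero_of_notMem_tsupport hout)))).2
    exact Set.mem_univ_pi.2 fun j => Set.mk_mem_prod (Set.mem_univ _) (hN₀ j c hc (η j).1 (η j).2 _ huB rfl)
  -- ONE call of ★ (A4-gen) on `(G_c ⧸ M_c) × Y`, then the prefactor
  have key := contDiffOn_integral_prod_descConj_fibre_of_uniformlyProper_of_param
    (Subgroup.pi Set.univ (fun i : ι => chartTorusGLoc L α (e i) S'))
    (c := fun (c : {w : InfinitePlace L // IsComplex w} → Fin 3 → ℝ) (i : ι) => gprimeBlock L α (e i) S' c)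
    (forall_mem_pi_chartTorusGLoc_comm L α S' e) (isOpen_inRegG (slotSign L α) S')
    (uniformlyProper_gprimeBlock_pi_inRegG L α S' hα hreal hS' e he) μ ν (Φ := Φ) hA₀ hΦC hfib p hp hpM r hr Ψ hΨ hfac
  have hgoal : (fun c : {w : InfinitePlace L // IsComplex w} → Fin 3 → ℝ => pref c *
        ∫ w : ((∀ i : ι, ↥(archLocal L 3 (Matrix.diagonal α) (e i))) ⧸ Subgroup.pi Set.univ (fun i : ι => chartTorusGLoc L α (e i) S')) ×
            (∀ j : κι, ↥(K j) × ↥(unipotentU (starRingEnd ℂ) J)),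
          descConj (fun i : ι => gprimeBlock L α (e i) S' c) (Subgroup.pi Set.univ (fun i : ι => chartTorusGLoc L α (e i) S'))
            (forall_mem_pi_chartTorusGLoc_comm L α S' e c)
            (fun g => a' (ρ (g, fun j => ((w.2 j).1 : ↥(unitaryGroupOfForm (starRingEnd ℂ) J)) *
              (τ ![0, c (es j) 1, c (es j) 2] * τ ![c (es j) 0 / 2, 0, 0] * ((w.2 j).2 : ↥(unitaryGroupOfForm (starRingEnd ℂ) J)) * τ ![c (es j) 0 / 2, 0, 0]) *
              ((w.2 j).1 : ↥(unitaryGroupOfForm (starRingEnd ℂ) J))⁻¹)))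
            w.1 ∂(μ.prod ν)) =
      fun c => pref c *
        ∫ w : ((∀ i : ι, ↥(archLocal L 3 (Matrix.diagonal α) (e i))) ⧸ Subgroup.pi Set.univ (fun i : ι => chartTorusGLoc L α (e i) S')) ×
            (∀ j : κι, ↥(K j) × ↥(unipotentU (starRingEnd ℂ) J)),
          descConj (fun i : ι => gprimeBlock L α (e i) S' c) (Subgroup.pi Set.univ (fun i : ι => chartTorusGLoc L α (e i) S'))
            (forall_mem_pi_chartTorusGLoc_comm L α S' e c) (fun g => Φ c g w.2) w.1 ∂(μ.prod ν) := by
    rw [hΦ]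
  rw [hgoal]
  exact hpref.mul key

end Model

end Literature.NumberTheory.Automorphic.UnitaryGroup

end
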